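import Summits.CriticalPhenomena.Ising3DConformalLimit.Theorems.PerfectScreeningCoulombImpliesNontrivialGapOfBinder
import Summits.CriticalPhenomena.Ising3DConformalLimit.Theorems.PerfectScreeningCoulombImpliesNontrivialOfLeeYangGap
import Summits.CriticalPhenomena.Ising3DConformalLimit.Theses.LeeYangGap
import Summits.CriticalPhenomena.Ising3DConformalLimit.Theses.LatticeSDPCertificates
import Summits.CriticalPhenomena.Ising3DConformalLimit.Theses.ArmHyperscaling
import Summits.CriticalPhenomena.Ising3DConformalLimit.Theses.IsingEuclidUpgrade
import Literature.Probability.LatticeModels.IsingBubbleDivergenceProofs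
import Literature.Probability.LatticeModels.IsingThermodynamics

/-!
# Strategy census s2 (independent) — typed companion for crux `NearCriticalLeeYangGap` (stmt-CriticalPhenomena-4945)

Route `LeeYangGap`, sub-problem `Ising3DConformalLimit`. This file only TYPES the statements the census
`STRATEGY-CENSUS-s2.md` argues about (no new route item, no registered line, no `sorry`):

* §1 slot-weakening: the weakest replacement of GAP in `closes` is item 0636 (`NGL` below), by name.
* §2 decomposition attempt D = (`PieceWindow` = item 5507 verbatim) ∧ (`FarMergingBox`), glue `BlockSummationGlue`.
* §3 strengthenings: `BinderNondecreasing` (rigidity that would make GAP inductive; proved to imply GAP given one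
  positive value, numerically false) and `UpperIsothermAtBlockScale` (h-direction amplitude hyperscaling).
* §5 negation: the proved rung under piece 1 — the bubble diverges on `ℤ³` (Duminil-Copin–Panis 2025, Thm 1.8),
  by name.
-/

noncomputable section

namespace Summit.CriticalPhenomena.Ising3DConformalLimit.Cruxes.NearCriticalLeeYangGap.StrategyCensusS2

open Literature.Probability.LatticeModels Filter
open scoped BigOperators Topology

/-- The crux, by name. -/
abbrev GAP : Prop := Summit.CriticalPhenomena.Ising3DConformalLimit.Theses.LeeYangGap.NearCriticalLeeYangGap

/-- `Σ_L = ⟨M_L²⟩_{β_c}` for the block `box 3 L = {-L,…,L}³`. -/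
def blockVar (L : ℕ) : ℝ :=
  plusExpect 3 (criticalBeta 3) 0 (fun σ => (∑ x ∈ box 3 L, spinAt x σ) ^ 2)

/-- `⟨M_L⁴⟩_{β_c}`. -/
def blockFourth (L : ℕ) : ℝ :=
  plusExpect 3 (criticalBeta 3) 0 (fun σ => (∑ x ∈ box 3 L, spinAt x σ) ^ 4)

/-- The block Binder cumulant `g_L = (3Σ_L² − ⟨M_L⁴⟩)/Σ_L² = −u₄(M_L)/Σ_L²` (same expression as in
`PerfectScreeningCoulombImpliesNontrivial.stub_gapOfBinderNonvanishing`). -/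
def blockBinder (L : ℕ) : ℝ :=
  (3 * (plusExpect 3 (criticalBeta 3) 0 (fun σ => (∑ x ∈ box 3 L, spinAt x σ) ^ 2)) ^ 2 -
      plusExpect 3 (criticalBeta 3) 0 (fun σ => (∑ x ∈ box 3 L, spinAt x σ) ^ 4)) /
    (plusExpect 3 (criticalBeta 3) 0 (fun σ => (∑ x ∈ box 3 L, spinAt x σ) ^ 2)) ^ 2

/-- In-tree equivalence used throughout the census: GAP ⟺ `¬ (g_L → 0)` (PerfectScreening line `SketchPub`,
both directions landed). -/
theorem gap_iff_binder_not_tendsto_zero : GAP ↔ ¬ Tendsto blockBinder atTop (𝓝 0) :=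
  ⟨PerfectScreeningCoulombImpliesNontrivial.sketchPub_binderNonvanishing_of_nearCriticalLeeYangGap,
    PerfectScreeningCoulombImpliesNontrivial.stub_gapOfBinderNonvanishing⟩

/-! ## §1 Slot-weakening from the summit statement -/

/-- The weakest statement that can replace GAP in the route's `closes` (given the residual `MoebiusLimitExists`,
item 1344): every non-degenerate pointwise scaling limit is non-Gaussian — item stmt-CriticalPhenomena-0636 verbatim,
imported BY NAME (not re-filed). -/
abbrev NGL : Prop := Summit.CriticalPhenomena.Ising3DConformalLimit.Theses.IsingEuclidUpgrade.IsingEuclidUpgradeR4NonGaussian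

/-! ## §2 Decomposition attempt D = PieceWindow ∧ FarMergingBox -/

/-- Piece 1 = item stmt-CriticalPhenomena-5507 `WindowBelowHalf` verbatim (two-point lower regularity with exponent
`3/2 − ε`, i.e. `η_eff < 1/2` uniformly across scales), imported BY NAME. -/
abbrev PieceWindow : Prop := Summit.CriticalPhenomena.Ising3DConformalLimit.Theses.LatticeSDPCertificates.WindowBelowHalf

/-- The lattice Ursell function of the critical state at a quadruple of sites. -/
def ursell4 (x : Fin 4 → Site 3) : ℝ :=
  criticalCorr 3 4 x -
    (criticalCorr 3 2 ![x 0, x 1] * criticalCorr 3 2 ![x 2, x 3] +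
      criticalCorr 3 2 ![x 0, x 2] * criticalCorr 3 2 ![x 1, x 3] +
      criticalCorr 3 2 ![x 0, x 3] * criticalCorr 3 2 ![x 1, x 2])

/-- Piece 2 (the hard piece): UNIFORM FAR MERGING IN THE BLOCK, frequently in `L` — for some `c > 0` and infinitely
many `L`, every quadruple of sites of `box 3 L` with all pairwise sup-distances `≥ L/8` has
`−U₄(x) ≥ c ⟨σ_{x₀}σ_{x₁}⟩⟨σ_{x₂}σ_{x₃}⟩` (by Aizenman's identity: the two independent sourced double currents of
`{x₀,x₁}` and `{x₂,x₃}` merge with probability `≥ c/2`). Clause (iii) in lattice dress, uniform-in-shape cousin of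
`ArmHyperscaling.MergingFloor` (stmt-15592, one shape, all small meshes) and of the far-merging hypothesis of
`EnergyNotSigmaSquared.FarMergingGivesU4` (stmt-4471). -/
def FarMergingBox : Prop :=
  ∃ c : ℝ, 0 < c ∧ ∃ᶠ L : ℕ in atTop, ∀ x : Fin 4 → Site 3,
    (∀ i, x i ∈ box 3 L) → (∀ i j, i ≠ j → (L : ℝ) / 8 ≤ ‖x i - x j‖) →
      c * (criticalCorr 3 2 ![x 0, x 1] * criticalCorr 3 2 ![x 2, x 3]) ≤ - ursell4 x

/-- The glue of D (block summation; judged PROVABLE, M-sized, not proved here): Lebowitz `U₄ ≤ 0` termwise drops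
the near quadruples from `−u₄(M_L) = −Σ_{(box 3 L)⁴} U₄`; piece 2 bounds the far part below by
`c·Σ_far ⟨⟩⟨⟩`; piece 1 (window ⇒ doubling ⇒ top-heavy box susceptibility) makes four `L/8`-separated sub-cubes carry
`≥ c'·Σ_L²`; then `g_L ≥ c c'` frequently and `gap_iff_binder_not_tendsto_zero` closes. -/
def BlockSummationGlue : Prop := PieceWindow → FarMergingBox → GAP

/-- `ε`-far quadruples: all six pairwise sup-distances are `≥ εL`. -/
def FarQuad (ε : ℝ) (L : ℕ) (x : Fin 4 → Site 3) : Prop := ∀ i j, i ≠ j → ε * (L : ℝ) ≤ ‖x i - x j‖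

open Classical in
/-- AVERAGED far merging at the block scale, frequently: an `ε`-far part of the block's `−U₄` mass is a positive
fraction of `Σ_L²`. The census shows GAP ⟺ `AveragedFarMerging` UNCONDITIONALLY (⟸: Lebowitz `U₄ ≤ 0` drops the
near quadruples from `−u₄(M_L) = −Σ U₄`; ⟹: the near mass is `≤ C ε³ Σ_L²` by the GKS pairing bound
`−U₄ ≤ G(02)G(13) + G(03)G(12)`, `Σ_L ≥ |box_{L/2}|·χ_{L/2}` and the sliding-scale infrared bound `χ_{2L} ≤ 16K χ_{L/2}`,
tree `aizenmanDuminilCopin_slidingScaleInfraredBound_holds`) — so the Lee–Yang dressing of the crux is removable and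
what remains is exactly the clause-(iii) lattice core. -/
def AveragedFarMerging : Prop :=
  ∃ ε c : ℝ, 0 < ε ∧ 0 < c ∧ ∃ᶠ L : ℕ in atTop,
    c * blockVar L ^ 2 ≤
      ∑ x ∈ (Fintype.piFinset fun _ : Fin 4 => box 3 L) with FarQuad ε L x, (- ursell4 x)

/-- The unconditional two-point input that replaces piece 1 in the "frequently" form: at infinitely many scales the
block two-point mass is top-heavy, `Σ_L ≤ C L⁶ ⟨σ₀σ_{2L e₀}⟩` (judged PROVABLE from the tree: ADC 2021 §5.6 pigeonhole
`RegularScales` Part C + sliding-scale IR bound + Messager–Miracle-Solé; not proved here). -/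
def TopHeavyFrequently : Prop :=
  ∃ C : ℝ, ∃ᶠ L : ℕ in atTop,
    blockVar L ≤ C * (L : ℝ) ^ 6 * criticalTwoPoint 3 (Pi.single 0 (2 * (L : ℤ)))

/-- Piece 2 in the quantifier shape the unconditional piece 1 can use: far merging for ALL large `L`. -/
def FarMergingBoxEventually : Prop :=
  ∃ c : ℝ, 0 < c ∧ ∀ᶠ L : ℕ in atTop, ∀ x : Fin 4 → Site 3,
    (∀ i, x i ∈ box 3 L) → (∀ i j, i ≠ j → (L : ℝ) / 8 ≤ ‖x i - x j‖) →
      c * (criticalCorr 3 2 ![x 0, x 1] * criticalCorr 3 2 ![x 2, x 3]) ≤ - ursell4 x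

/-- The degenerate form of D once piece 1 is discharged: a one-piece TRANSFER `FarMergingBoxEventually ⟹ GAP` through
the theorem-grade `TopHeavyFrequently` (glue judged provable, M-sized). -/
def TransferGlue : Prop := TopHeavyFrequently → FarMergingBoxEventually → GAP

/-- The one-shape merging floor of route ArmHyperscaling, by name (for comparison in the census). -/
abbrev OneShapeMergingFloor : Prop := Summit.CriticalPhenomena.Ising3DConformalLimit.Theses.ArmHyperscaling.MergingFloor

/-! ## §3 Strengthenings -/

/-- S⁺₁ (rigidity that would make GAP inductive): the block Binder cumulant is non-decreasing in the block size.
With `g_0 = 2 > 0` (single site) it would give GAP at once (`gap_of_binderNondecreasing`). Numerically FALSE at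
small sides (job j026695 on the item: `g ≈ 0.93 → 0.85` from side 7 to side 11). -/
def BinderNondecreasing : Prop := ∀ L : ℕ, blockBinder L ≤ blockBinder (L + 1)

theorem blockBinder_mono_of_nondecreasing (h : BinderNondecreasing) : Monotone blockBinder :=
  monotone_nat_of_le_succ h

/-- S⁺₁ ⟹ GAP given one positive value of the cumulant (proved: a monotone sequence above a positive level does
not tend to `0`). -/
theorem gap_of_binderNondecreasing (h : BinderNondecreasing) (h0 : ∃ L₀, 0 < blockBinder L₀) : GAP := by
  obtain ⟨L₀, hL₀⟩ := h0
  rw [gap_iff_binder_not_tendsto_zero]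
  intro htend
  have hmono : Monotone blockBinder := blockBinder_mono_of_nondecreasing h
  have hev : ∀ᶠ L in atTop, blockBinder L ∈ Set.Iio (blockBinder L₀) :=
    htend.eventually_mem (Iio_mem_nhds hL₀)
  obtain ⟨L, hL₁, hL₂⟩ := (hev.and (eventually_ge_atTop L₀)).exists
  exact (not_le.2 (Set.mem_Iio.1 hL₁)) (hmono hL₂)

/-- S⁺₂ (h-direction amplitude hyperscaling, "upper critical isotherm at the block's own field scale"): for some
`s, ε > 0` and infinitely many `L`, with `h_L = s·Σ_L^{-1/2}`,
`|box 3 L| · (ψ(β_c, h_L) − ψ(β_c, 0)) ≤ (1 − ε) s²/2` (`ψ` = infinite-volume pressure). By Griffiths' field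
monotonicity `log ⟨e^{h M_L}⟩_{β_c} ≤ |box 3 L|(ψ(β_c,h) − ψ(β_c,0))`, so S⁺₂ gives the moment-generating-function
deficit at `h_L`, hence `g_L ≥ 12ε/s²` by Newman's Lee–Yang lower bound, hence GAP. Coulomb-free cousin of
PerfectScreening's residual `stub_upperCriticalIsothermFrequently`. -/
def UpperIsothermAtBlockScale : Prop :=
  ∃ s ε : ℝ, 0 < s ∧ 0 < ε ∧ ∃ᶠ L : ℕ in atTop,
    ((box 3 L).card : ℝ) *
        (pressure 3 (criticalBeta 3) (s / Real.sqrt (blockVar L)) - pressure 3 (criticalBeta 3) 0) ≤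
      (1 - ε) * s ^ 2 / 2

/-- The implication S⁺₂ ⟹ GAP as a statement (judged provable from tree facts: Griffiths II in the field, the
pressure as a box limit, Newman's bound `exp(u₂r²/2 + u₄r⁴/24) ≤ ⟨e^{rM}⟩`; not proved here). -/
def UpperIsothermGivesGap : Prop := UpperIsothermAtBlockScale → GAP

/-! ## §5 Negation: the rung under piece 1 that IS a theorem -/

/-- The finite-bubble (Aizenman–Fröhlich) mechanism for Gaussian block spins is dead on `ℤ³`: the critical bubble
diagram diverges (Duminil-Copin–Panis, CMP 2025 = arXiv:2404.05700, Theorem 1.8; tree theorem, by name). What is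
NOT excluded by any theorem is the marginal scenario `η = 1/2` with logarithmic bubble growth (ibid. Thm 1.5,
Remark 1.9: `B_n ≥ c √(log n)` only), under which the `d = 4` mechanism (ADC 2021) would make GAP false. -/
theorem bubble_diverges_Z3 :
    ∑' x : Site 3, ENNReal.ofReal (twoPointFree 3 (criticalBeta 3) x) ^ 2 = ⊤ :=
  DuminilCopinPanis2025_bubbleDiagram_eq_top_holds.three

end Summit.CriticalPhenomena.Ising3DConformalLimit.Cruxes.NearCriticalLeeYangGap.StrategyCensusS2

end
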